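import Mathlib.Analysis.SpecialFunctions.Pow.Real
import Mathlib.Analysis.SpecialFunctions.Sqrt
import HarnessLib

/-!
# Band inequalities for the fcc slot heights: no four of the six pair heights are small

HONEST FRAMING. Part of the venture `Summits/Ventures/Crystal3D` (cell `crystal3d-full`), helper for the
crux `GenericWallFloor` (stmt-Ventures-19480) of `route-Ventures-StickyWulffConstant`, line `WallLedgerG`,
rigid-bicrystal rung of `stub_twoSlabAdhesion` (note RIGID-RUNG-ARCH on the item): the real-inequality
half of the BAND LEMMA (`…GenericWallFloorBandLemma.lean`: at most six slots of the fcc kissing shell have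
height `|⟪w, ν⟫| ≤ √2 − 1`).  With cubic coordinates `(a, b, c)` of a unit vector (`a² + b² + c² = 2`) the
twelve slot heights are `±(a ± b)/2, ±(a ± c)/2, ±(b ± c)/2`; writing `k = 2(√2 − 1)`:

* `not_four_small_heights_B` — two complete pairs `|x ± y|, |x ± z| ≤ k` are impossible (`8(√2−1)² < 2`);
* `not_four_small_heights_A` — a complete pair `|x ± y| ≤ k` plus one height from each other pair is
  impossible (`11(√2−1)² = 33 − 22√2 < 2`; the minimax of the fourth smallest pair height is `2·3/√22`,
  attained at `ν ∝ (1,1,3)`, kit j278739);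
* wrappers in the `(a, b, c)` alphabet and the propositional count `sum_six_indicators_le_three`.

Elementary real algebra; nothing about packings.  WHAT THIS IS NOT: the counting half; rung F-C1 not moved.
-/

noncomputable section

namespace Summit.Ventures.Crystal3D.Theorems

/-! ## The real inequalities -/

/-- `33 − 22 √2 < 2`, i.e. `11 (√2 − 1)² < 2` (squares: `31² = 961 < 968 = 2·22²`). -/
theorem eleven_mul_sq_sqrt_two_sub_one_lt_two : 11 * (Real.sqrt 2 - 1) ^ 2 < 2 := by
  have h2 : Real.sqrt 2 ^ 2 = 2 := Real.sq_sqrt (by norm_num)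
  have hlo : (141 : ℝ) / 100 < Real.sqrt 2 := by
    rw [show (141 : ℝ) / 100 = Real.sqrt ((141 / 100) ^ 2) by rw [Real.sqrt_sq (by norm_num)]]
    exact Real.sqrt_lt_sqrt (by norm_num) (by norm_num)
  nlinarith

/-- `|x| + |y| ≤ k` from `|x + y| ≤ k` and `|x − y| ≤ k`. -/
theorem abs_add_abs_le_of_abs_add_abs_sub {x y k : ℝ} (h₁ : |x + y| ≤ k) (h₂ : |x - y| ≤ k) :
    |x| + |y| ≤ k := by
  rcases le_total 0 x with hx | hx <;> rcases le_total 0 y with hy | hy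
  · rw [abs_of_nonneg hx, abs_of_nonneg hy]; linarith [(abs_le.1 h₁).2]
  · rw [abs_of_nonneg hx, abs_of_nonpos hy]; linarith [(abs_le.1 h₂).2]
  · rw [abs_of_nonpos hx, abs_of_nonneg hy]; linarith [(abs_le.1 h₂).1]
  · rw [abs_of_nonpos hx, abs_of_nonpos hy]; linarith [(abs_le.1 h₁).1]

/-- Case B: two complete pairs `|x ± y|, |x ± z| ≤ 2(√2−1)` are impossible when `x² + y² + z² = 2`. -/
theorem not_four_small_heights_B (x y z : ℝ) (h2 : x ^ 2 + y ^ 2 + z ^ 2 = 2)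
    (h₁ : |x + y| ≤ 2 * (Real.sqrt 2 - 1)) (h₂ : |x - y| ≤ 2 * (Real.sqrt 2 - 1))
    (h₃ : |x + z| ≤ 2 * (Real.sqrt 2 - 1)) (h₄ : |x - z| ≤ 2 * (Real.sqrt 2 - 1)) : False := by
  have hk := eleven_mul_sq_sqrt_two_sub_one_lt_two
  have hk0 : 0 ≤ Real.sqrt 2 - 1 := by
    have : (1 : ℝ) ≤ Real.sqrt 2 := Real.one_le_sqrt.2 (by norm_num); linarith
  have hxy := abs_add_abs_le_of_abs_add_abs_sub h₁ h₂
  have hxz := abs_add_abs_le_of_abs_add_abs_sub h₃ h₄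
  have h0x := abs_nonneg x; have h0y := abs_nonneg y; have h0z := abs_nonneg z
  have hx2 : |x| ^ 2 = x ^ 2 := sq_abs x
  have hy2 : |y| ^ 2 = y ^ 2 := sq_abs y
  have hz2 : |z| ^ 2 = z ^ 2 := sq_abs z
  -- `x² + y² ≤ (|x|+|y|)² ≤ 4(√2−1)²`, `x² + z² ≤ 4(√2−1)²`, so `2 ≤ 8(√2−1)² < 2`
  nlinarith [mul_le_mul hxy hxy (by positivity) (by positivity),
    mul_le_mul hxz hxz (by positivity) (by positivity)]

/-- Case A: a complete pair `|x ± y| ≤ 2(√2−1)` together with one height from each of the other two pairs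
is impossible when `x² + y² + z² = 2` (`3X² + 2k² ≤ 11k²/4` with `X = min(|x|,|y|) ≤ k/2`). -/
theorem not_four_small_heights_A (x y z : ℝ) (h2 : x ^ 2 + y ^ 2 + z ^ 2 = 2)
    (h₁ : |x + y| ≤ 2 * (Real.sqrt 2 - 1)) (h₂ : |x - y| ≤ 2 * (Real.sqrt 2 - 1))
    (h₃ : |x + z| ≤ 2 * (Real.sqrt 2 - 1) ∨ |x - z| ≤ 2 * (Real.sqrt 2 - 1))
    (h₄ : |y + z| ≤ 2 * (Real.sqrt 2 - 1) ∨ |y - z| ≤ 2 * (Real.sqrt 2 - 1)) : False := by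
  have hk := eleven_mul_sq_sqrt_two_sub_one_lt_two
  set k : ℝ := Real.sqrt 2 - 1 with hkdef
  have hk0 : 0 ≤ k := by
    have : (1 : ℝ) ≤ Real.sqrt 2 := Real.one_le_sqrt.2 (by norm_num); rw [hkdef]; linarith
  have hxy := abs_add_abs_le_of_abs_add_abs_sub h₁ h₂
  have h0x := abs_nonneg x; have h0y := abs_nonneg y; have h0z := abs_nonneg z
  have hx2 : |x| ^ 2 = x ^ 2 := sq_abs x
  have hy2 : |y| ^ 2 = y ^ 2 := sq_abs y
  have hz2 : |z| ^ 2 = z ^ 2 := sq_abs z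
  -- `|z| ≤ 2k + |x|` and `|z| ≤ 2k + |y|`
  have hzx : |z| ≤ 2 * k + |x| := by
    rcases h₃ with h | h
    · have h' := abs_add_le (x + z) (-x)
      rw [abs_neg, show x + z + -x = z by ring] at h'; linarith
    · have h' := abs_add_le (-(x - z)) x
      rw [abs_neg, show -(x - z) + x = z by ring] at h'; linarith
  have hzy : |z| ≤ 2 * k + |y| := by
    rcases h₄ with h | h
    · have h' := abs_add_le (y + z) (-y)
      rw [abs_neg, show y + z + -y = z by ring] at h'; linarith
    · have h' := abs_add_le (-(y - z)) y
      rw [abs_neg, show -(y - z) + y = z by ring] at h'; linarith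
  rcases le_total |x| |y| with hle | hle
  · -- `X = |x| ≤ k`, `|y| ≤ 2k − X`, `|z| ≤ 2k + X`
    have hX : |x| ≤ k := by linarith
    have hY : |y| ≤ 2 * k - |x| := by linarith
    have hY0 : 0 ≤ 2 * k - |x| := by linarith
    nlinarith [mul_le_mul hY hY h0y hY0, mul_le_mul hzx hzx h0z (by linarith),
      mul_le_mul hX hX h0x hk0]
  · have hY : |y| ≤ k := by linarith
    have hX : |x| ≤ 2 * k - |y| := by linarith
    have hX0 : 0 ≤ 2 * k - |y| := by linarith
    nlinarith [mul_le_mul hX hX h0x hX0, mul_le_mul hzy hzy h0z (by linarith),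
      mul_le_mul hY hY h0y hk0]

/-! ## Wrappers of the two cases in the `(a, b, c)` alphabet -/

/-- pairs `ab, bc` complete: impossible. -/
theorem not_small_ab_bc (a b c : ℝ) (h2 : a ^ 2 + b ^ 2 + c ^ 2 = 2)
    (h₁ : |a + b| ≤ 2 * (Real.sqrt 2 - 1)) (h₂ : |a - b| ≤ 2 * (Real.sqrt 2 - 1))
    (h₃ : |b + c| ≤ 2 * (Real.sqrt 2 - 1)) (h₄ : |b - c| ≤ 2 * (Real.sqrt 2 - 1)) : False := by
  refine not_four_small_heights_B b a c (by linarith) ?_ ?_ h₃ h₄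
  · rwa [add_comm]
  · rwa [abs_sub_comm]

/-- pairs `ac, bc` complete: impossible. -/
theorem not_small_ac_bc (a b c : ℝ) (h2 : a ^ 2 + b ^ 2 + c ^ 2 = 2)
    (h₁ : |a + c| ≤ 2 * (Real.sqrt 2 - 1)) (h₂ : |a - c| ≤ 2 * (Real.sqrt 2 - 1))
    (h₃ : |b + c| ≤ 2 * (Real.sqrt 2 - 1)) (h₄ : |b - c| ≤ 2 * (Real.sqrt 2 - 1)) : False := by
  refine not_four_small_heights_B c a b (by linarith) ?_ ?_ ?_ ?_
  · rwa [add_comm]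
  · rwa [abs_sub_comm]
  · rwa [add_comm]
  · rwa [abs_sub_comm]

/-- pair `ac` complete plus one of `ab`, one of `bc`: impossible. -/
theorem not_small_ac_A (a b c : ℝ) (h2 : a ^ 2 + b ^ 2 + c ^ 2 = 2)
    (h₁ : |a + c| ≤ 2 * (Real.sqrt 2 - 1)) (h₂ : |a - c| ≤ 2 * (Real.sqrt 2 - 1))
    (h₃ : |a + b| ≤ 2 * (Real.sqrt 2 - 1) ∨ |a - b| ≤ 2 * (Real.sqrt 2 - 1))
    (h₄ : |b + c| ≤ 2 * (Real.sqrt 2 - 1) ∨ |b - c| ≤ 2 * (Real.sqrt 2 - 1)) : False := by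
  refine not_four_small_heights_A a c b (by linarith) h₁ h₂ h₃ ?_
  rcases h₄ with h | h
  · left; rwa [add_comm]
  · right; rwa [abs_sub_comm]

/-- pair `bc` complete plus one of `ab`, one of `ac`: impossible. -/
theorem not_small_bc_A (a b c : ℝ) (h2 : a ^ 2 + b ^ 2 + c ^ 2 = 2)
    (h₁ : |b + c| ≤ 2 * (Real.sqrt 2 - 1)) (h₂ : |b - c| ≤ 2 * (Real.sqrt 2 - 1))
    (h₃ : |a + b| ≤ 2 * (Real.sqrt 2 - 1) ∨ |a - b| ≤ 2 * (Real.sqrt 2 - 1))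
    (h₄ : |a + c| ≤ 2 * (Real.sqrt 2 - 1) ∨ |a - c| ≤ 2 * (Real.sqrt 2 - 1)) : False := by
  refine not_four_small_heights_A b c a (by linarith) h₁ h₂ ?_ ?_
  · rcases h₃ with h | h
    · left; rwa [add_comm]
    · right; rwa [abs_sub_comm]
  · rcases h₄ with h | h
    · left; rwa [add_comm]
    · right; rwa [abs_sub_comm]

/-- Six indicators in three antipodal-pair groups: if no two groups are both complete and no complete group
meets the two others, at most three indicators are set. -/
theorem sum_six_indicators_le_three (p₁ p₂ p₃ p₄ p₅ p₆ : Prop) [Decidable p₁] [Decidable p₂]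
    [Decidable p₃] [Decidable p₄] [Decidable p₅] [Decidable p₆]
    (fB1 : p₁ → p₂ → p₃ → p₄ → False) (fB2 : p₁ → p₂ → p₅ → p₆ → False)
    (fB3 : p₃ → p₄ → p₅ → p₆ → False)
    (fA1 : p₁ → p₂ → (p₃ ∨ p₄) → (p₅ ∨ p₆) → False) (fA2 : p₃ → p₄ → (p₁ ∨ p₂) → (p₅ ∨ p₆) → False)
    (fA3 : p₅ → p₆ → (p₁ ∨ p₂) → (p₃ ∨ p₄) → False) :
    (if p₁ then 1 else 0) + (if p₂ then 1 else 0) + (if p₃ then 1 else 0) + (if p₄ then 1 else 0) +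
      (if p₅ then 1 else 0) + (if p₆ then 1 else 0) ≤ (3 : ℕ) := by
  by_cases h₁ : p₁ <;> by_cases h₂ : p₂ <;> by_cases h₃ : p₃ <;> by_cases h₄ : p₄ <;>
    by_cases h₅ : p₅ <;> by_cases h₆ : p₆ <;>
    simp only [h₁, h₂, h₃, h₄, h₅, h₆, if_true, if_false] <;>
    first
    | decide
    | exact (fB1 h₁ h₂ h₃ h₄).elim
    | exact (fB2 h₁ h₂ h₅ h₆).elim
    | exact (fB3 h₃ h₄ h₅ h₆).elim
    | exact (fA1 h₁ h₂ (Or.inl h₃) (Or.inl h₅)).elim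
    | exact (fA1 h₁ h₂ (Or.inl h₃) (Or.inr h₆)).elim
    | exact (fA1 h₁ h₂ (Or.inr h₄) (Or.inl h₅)).elim
    | exact (fA1 h₁ h₂ (Or.inr h₄) (Or.inr h₆)).elim
    | exact (fA2 h₃ h₄ (Or.inl h₁) (Or.inl h₅)).elim
    | exact (fA2 h₃ h₄ (Or.inl h₁) (Or.inr h₆)).elim
    | exact (fA2 h₃ h₄ (Or.inr h₂) (Or.inl h₅)).elim
    | exact (fA2 h₃ h₄ (Or.inr h₂) (Or.inr h₆)).elim
    | exact (fA3 h₅ h₆ (Or.inl h₁) (Or.inl h₃)).elim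
    | exact (fA3 h₅ h₆ (Or.inl h₁) (Or.inr h₄)).elim
    | exact (fA3 h₅ h₆ (Or.inr h₂) (Or.inl h₃)).elim
    | exact (fA3 h₅ h₆ (Or.inr h₂) (Or.inr h₄)).elim

end Summit.Ventures.Crystal3D.Theorems

end
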